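import Summits.BirchSwinnertonDyer.BirchSwinnertonDyer.Theorems.ResidualThetaTransportAtTwoSignedMuVanishingAtTwoPlusCuspSpanGenerationTwoPrimes
import Summits.BirchSwinnertonDyer.BirchSwinnertonDyer.Theorems.ResidualThetaTransportAtTwoSignedMuVanishingAtTwoPlusCuspSpanRowsThreePrimesTools
import Summits.BirchSwinnertonDyer.BirchSwinnertonDyer.Theorems.ResidualThetaTransportAtTwoThetaLayerLambdaCongruenceAtTwoCuspSpanRowsTwoFour
import HarnessLib

/-!
# Node (G′)_N = `CuspSpanEvenAtTwo N` (item 27436; cruxes Kμ⁺ 20689 / Kan⁺ 20688 / 21437): the ROWS `{1, 2, 4}` GENERATE `Γ₀(N)`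
# modulo small trace at EVERY odd level with AT MOST THREE distinct prime factors; hence **`CuspSpanEvenAtTwo N` for every odd `N`
# with `ω(N) ≤ 3`** — all `p^a q^b r^c`, including the levels `p²q²`, `p³q`, `pqr` where the `B₁`-descent («Lemma P») fails

Cell `bsd-wall`, width seat `bsd-wall-rtt-p4-w2` g7 (crux Kμ⁺ stmt-BirchSwinnertonDyer-20689, line `birth`, stub `stub_flatMuZeroAtTwo` ⟸ node
27436). THEOREMS ONLY (no `def`, no named fact, no `sorry`); helper `--supports` the crux; BSD is not proved by this; item 27436 (all odd `N`)
is NOT closed by this file (levels with `ω(N) ≥ 4` remain).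

CONTEXT. At an odd level the node is EXACTLY the generation statement (G‴)_N «every additive `χ : Γ₀(N) → 𝔽₂` killing the elements of
trace `0, ±1, ±2`, the `|d| = 4^k` elements and the row `|b| = 1` vanishes» (rtt-p3-w4 g2, `cuspSpanEvenAtTwo_of_forall_b1_odd`,
p638351), and the rows `|b| = 2`, `|b| = 4^i` are killed for free (`chi_eq_zero_of_natAbs_b_eq_two_odd`,
`chi_eq_zero_of_natAbs_b_eq_four_pow_odd`, p639370). The lead's `TwoPrimes.chi_eq_zero_of_forall_b1` (p639423) generates `Γ₀(p^a q)`,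
`a ≤ 2`, from `B₁` alone; at `p²q²`, `p³q`, `pqr` that is false (exact 𝔽₂ linear algebra). EXACT NUMERICS of this seat (full row families
`B_m = {|b| = m}`, classes `{0 → m/d}` for `d mod mN` — χ on `B_m` depends on `d mod mN`; the earlier «M(N)» table of
`Cruxes/SignedMuVanishingAtTwoPlus/MersenneChain.md` §3g used one `d` per class mod `N` and overestimates): `B₁ ∪ B₂ ∪ B₄` span ALL of
`H₁(X₀(N); 𝔽₂)` at every odd composite `N ≤ 4001` with `ω(N) ≤ 3` (`B₁ ∪ B₂` at every `p^a q^b`), and `B₁ ∪ B₂ ∪ B₄ ∪ B₈` at every tested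
level with `ω(N) ∈ {4, 5}` (1155, 1365, …, 6435, 15015); 0 failures.

THEOREM (`Rows124.chi_eq_zero_of_rows124`). Let `N` be odd with `N.primeFactors.card ≤ 3`. Every `χ : Γ₀(N) → ZMod 2` which is additive,
kills the elements of trace `0, ±1, ±2` and kills every element whose upper-right entry has absolute value `1`, `2` or `4` vanishes
identically.

PROOF (Farey parents, three local moves; no parabolic walk, no certificate). Induct on `|d(γ)|`; `x = (b, d) = γ e₂`, `d` prime to `N`.
`|d| ≤ 1`: a small-trace element up to `T`-powers (`d = 0` forces `|b| = 1`). `d ≥ 2`: Farey parents `y = (b₁, d₁)`, `y′ = (b₂, d₂)`,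
`x = y + y′`, `b₁ d₂ − b₂ d₁ = ±1`. Two elements of `Γ₀(N)` whose second columns are at determinant `±m` differ by a `|b| = m` element
(`γ⁻¹γ′` has upper-right entry `d b′ − b d′`), so their `χ`-values agree whenever the row `m` is killed (`chi_eq_of_secondCol_of_natAbs`).
If a parent is good: `m = 1` and induction. If both are bad (`p ∣ d₁`, `q ∣ d₂`, WLOG `d₁ < d₂`): `z₁ = y′ − y` is at determinant `2` from
`x` and `|d(z₁)| < d`; `z₃ = y′ − 3y` is at determinant `4` and `|d(z₃)| < d`; and `w = y′ + 2y` (any size) is at determinant `1` from `x`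
and at determinant `4` from `z₂ = y′ − 2y`, `|d(z₂)| < d`. If `z₁` is good, or `z₃` is good, or both `w, z₂` are good, the induction closes.
Otherwise `N` has prime factors `p ∣ d₁`, `q ∣ d₂`, `r ∣ d₂ − d₁`, `s ∣ d₂ − 3d₁` and `t ∣ d₂ ∓ 2d₁`, and (all odd, `gcd(d₁,d₂) = 1`)
`p, q, r` are pairwise distinct, `s ∉ {p, r}`, `s = q` forces `q = 3`, and then `t ∉ {p, q, r}` — four distinct primes (§2
`four_le_card_primeFactors`), contradicting `ω(N) ≤ 3`.

§4 THE NODE: `Rows124.cuspSpanEvenAtTwo_of_card_primeFactors_le_three : Odd N → N.primeFactors.card ≤ 3 → CuspSpanEvenAtTwo N`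
(UNCONDITIONAL; composing §3 with p638351 and p639370), `cuspSpanEvenAtTwo_threePrimes` (`N = p^a q^b r^c`, odd primes),
`flatAtTwo_of_conductor_card_primeFactors_le_three` (FLAT = `2 ∤ L⁻` for every Pollack pair at `2`, for every `W` good supersingular at `2`
with `a₂ = 0` and `ω(N_W) ≤ 3`). What remains of item 27436 class-wide: odd `N` with `ω(N) ≥ 4`, where numerically the rows `{1,2,4,8}`
still generate (all tested levels) — a pure generation statement, no `4^k`-element left in it.

References: R. S. Kulkarni, Amer. J. Math. 113 (1991) 1053–1133, §2 (Farey symbols) [Kulkarni1991]; H. Rademacher, Abh. Math. Sem.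
Hamburg 7 (1929) §1 [Rademacher1929]; A. W. Knapp, *Elliptic curves* (1992) Prop. 11.22 [Knapp1993]; R. Pollack, Duke Math. J. 118 (2003)
Conj. 6.3 [Pollack2003].
-/

set_option autoImplicit false
set_option linter.dupNamespace false

noncomputable section

open scoped MatrixGroups

open CongruenceSubgroup WeierstrassCurve Literature.NumberTheory.EllipticCurves
  Literature.NumberTheory.EllipticCurves.ModularForms Literature.NumberTheory.EllipticCurves.Rank1Residual
  Summit.BirchSwinnertonDyer.Rank1Residual.Supersingular

namespace Summit.BirchSwinnertonDyer.BirchSwinnertonDyer.Theorems.SignedMuAtTwo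

namespace Rows124

open TwoPrimes

variable {N : ℕ} {χ : Gamma0 N → ZMod 2}

/-! ## §3. The generation theorem: rows `{1, 2, 4}` at every odd level with at most three prime factors -/

/-- **ROWS `{1, 2, 4}` GENERATE `Γ₀(N)` MODULO SMALL TRACE, `ω(N) ≤ 3`.** Let `N` be odd with at most three distinct prime factors. Every
additive `χ : Γ₀(N) → ZMod 2` killing the elements of trace `0, ±1, ±2` and every element whose upper-right entry has absolute value `1`,
`2` or `4` vanishes identically. Proof in the module docstring (Farey parents; for two bad parents `y, y′` with `d(y) < d(y′)` one of the
moves `x ↔ y′ − y` (determinant `2`), `x ↔ y′ − 3y` (determinant `4`), `x ↔ y′ + 2y ↔ y′ − 2y` (determinants `1`, `4`) lands on good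
columns, or else `N` has four prime factors). [cite: Kulkarni1991, §2 (Farey symbols)] [cite: Rademacher1929, §1] -/
theorem chi_eq_zero_of_rows124 (hN : Odd N) (hω : N.primeFactors.card ≤ 3)
    (hadd : ∀ γ δ : Gamma0 N, χ (γ * δ) = χ γ + χ δ)
    (hsmall : ∀ γ : Gamma0 N, ((γ : SL(2, ℤ)) 0 0 + (γ : SL(2, ℤ)) 1 1).natAbs ≤ 2 → χ γ = 0)
    (hB1 : ∀ β : Gamma0 N, ((β : SL(2, ℤ)) 0 1).natAbs = 1 → χ β = 0)
    (hB2 : ∀ β : Gamma0 N, ((β : SL(2, ℤ)) 0 1).natAbs = 2 → χ β = 0)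
    (hB4 : ∀ β : Gamma0 N, ((β : SL(2, ℤ)) 0 1).natAbs = 4 → χ β = 0) :
    ∀ γ : Gamma0 N, χ γ = 0 := by
  -- strong induction on `|d|`
  suffices h : ∀ n : ℕ, ∀ γ : Gamma0 N, ((γ : SL(2, ℤ)) 1 1).natAbs = n → χ γ = 0 from fun γ ↦ h _ γ rfl
  intro n
  induction n using Nat.strong_induction_on with
  | _ n ih =>
  -- first the case `d > 0`
  have core : ∀ γ : Gamma0 N, 0 < (γ : SL(2, ℤ)) 1 1 → ((γ : SL(2, ℤ)) 1 1).natAbs = n → χ γ = 0 := by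
    intro γ hdpos hn
    set b := (γ : SL(2, ℤ)) 0 1 with hbdef
    set d := (γ : SL(2, ℤ)) 1 1 with hddef
    rcases Nat.lt_or_ge n 2 with hlt | hge
    · exact chi_eq_zero_of_natAbs_d_le_one' hadd hsmall hB1 γ (by rw [← hddef, hn]; omega)
    · have hd2 : 2 ≤ d := by omega
      have hdet : (γ : SL(2, ℤ)) 0 0 * d - b * (γ : SL(2, ℤ)) 1 0 = 1 := by
        have := Matrix.SpecialLinearGroup.det_coe (γ : SL(2, ℤ))
        rwa [Matrix.det_fin_two] at this
      have hcop : IsCoprime b d := ⟨-(γ : SL(2, ℤ)) 1 0, (γ : SL(2, ℤ)) 0 0, by linear_combination hdet⟩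
      -- Farey parent `y = (b', d')` with `b d' - d b' = 1`, `0 < d' < d`
      obtain ⟨u, v, huv⟩ := hcop
      set k := u / d with hkdef
      set d' := u % d with hd'def
      set b' := -v - k * b with hb'def
      have hud : d * k + d' = u := Int.mul_ediv_add_emod u d
      have hdet' : b * d' - d * b' = 1 := by
        rw [hb'def]
        have : d' = u - d * k := by linear_combination hud
        rw [this]
        linear_combination huv
      have hd'nn : 0 ≤ d' := Int.emod_nonneg _ (by omega)
      have hd'lt : d' < d := Int.emod_lt_of_pos _ (by omega)
      have hd'pos : 0 < d' := by
        rcases lt_or_eq_of_le hd'nn with h | h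
        · exact h
        · exfalso
          rw [← h, mul_zero, zero_sub] at hdet'
          have h1 := congrArg Int.natAbs hdet'
          rw [Int.natAbs_neg, Int.natAbs_mul] at h1
          have := Nat.eq_one_of_mul_eq_one_right (by simpa using h1)
          omega
      have hcop_y : IsCoprime b' d' := ⟨-d, b, by linear_combination hdet'⟩
      have hcop_y' : IsCoprime (b - b') (d - d') := ⟨d', -b', by linear_combination hdet'⟩
      -- Case A: the parent `y` is good
      by_cases hgy : IsCoprime d' (N : ℤ)
      · obtain ⟨γy, hy01, hy11⟩ := exists_gamma0_secondCol (N := N) b' d' hcop_y hgy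
        have hχy : χ γy = 0 := ih d'.natAbs (by rw [← hn]; omega) γy (by rw [hy11])
        rw [← hχy]
        refine (chi_eq_of_secondCol hadd hsmall hB1 γy γ ?_).symm
        rw [hy01, hy11, ← hbdef, ← hddef]
        have : d' * b - b' * d = 1 := by linear_combination hdet'
        rw [this]; rfl
      -- Case A': the parent `y' = x - y` is good
      by_cases hgy' : IsCoprime (d - d') (N : ℤ)
      · obtain ⟨γy, hy01, hy11⟩ := exists_gamma0_secondCol (N := N) (b - b') (d - d') hcop_y' hgy'
        have hχy : χ γy = 0 := ih (d - d').natAbs (by rw [← hn]; omega) γy (by rw [hy11])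
        rw [← hχy]
        refine (chi_eq_of_secondCol hadd hsmall hB1 γy γ ?_).symm
        rw [hy01, hy11, ← hbdef, ← hddef]
        have : (d - d') * b - (b - b') * d = -1 := by linear_combination (-1 : ℤ) * hdet'
        rw [this]; rfl
      -- Case B: both parents bad. The three moves, for parents `(b₁, d₁)`, `(b₂, d₂)` with `d₁ < d₂`, `b₁ d₂ - b₂ d₁ = e = ±1`.
      have step : ∀ (b₁ d₁ b₂ d₂ e : ℤ), (e = 1 ∨ e = -1) → b₁ + b₂ = b → d₁ + d₂ = d → b₁ * d₂ - b₂ * d₁ = e →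
          0 < d₁ → d₁ < d₂ → ¬ IsCoprime d₁ (N : ℤ) → ¬ IsCoprime d₂ (N : ℤ) → χ γ = 0 := by
        intro b₁ d₁ b₂ d₂ e he hb12 hd12 hdet₁ hd₁pos hd₁lt hbad₁ hbad₂
        have he2 : e * e = 1 := by rcases he with h | h <;> rw [h] <;> norm_num
        -- every column `y' + j y = (b₂ + j b₁, d₂ + j d₁)` is primitive
        have hcop_j : ∀ j : ℤ, IsCoprime (b₂ + j * b₁) (d₂ + j * d₁) := fun j ↦
          ⟨-(e * d₁), e * b₁, by linear_combination e * hdet₁ + he2⟩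
        -- the determinant of `y' + j y` against `x = y + y'` is `(1 - j) e`, against `y' + j' y` it is `(j' - j) e`
        have hdetj : ∀ j : ℤ, (d₂ + j * d₁) * b - (b₂ + j * b₁) * d = (1 - j) * e := by
          intro j; rw [← hb12, ← hd12]; linear_combination (1 - j) * hdet₁
        -- move 1: `z₁ = y' - y`, determinant `2`
        by_cases hg1 : IsCoprime (d₂ + (-1) * d₁) (N : ℤ)
        · obtain ⟨γz, hz01, hz11⟩ := exists_gamma0_secondCol (N := N) _ _ (hcop_j (-1)) hg1
          have hχz : χ γz = 0 := ih (d₂ + (-1) * d₁).natAbs (by rw [← hn, ← hd12]; omega) γz (by rw [hz11])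
          rw [← hχz]
          refine (chi_eq_of_secondCol_of_natAbs hadd hB2 γz γ ?_).symm
          rw [hz01, hz11, ← hbdef, ← hddef, hdetj]
          rcases he with h | h <;> rw [h] <;> norm_num
        -- move 2: `z₃ = y' - 3y`, determinant `4`
        by_cases hg3 : IsCoprime (d₂ + (-3) * d₁) (N : ℤ)
        · obtain ⟨γz, hz01, hz11⟩ := exists_gamma0_secondCol (N := N) _ _ (hcop_j (-3)) hg3
          have hχz : χ γz = 0 := ih (d₂ + (-3) * d₁).natAbs (by rw [← hn, ← hd12]; omega) γz (by rw [hz11])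
          rw [← hχz]
          refine (chi_eq_of_secondCol_of_natAbs hadd hB4 γz γ ?_).symm
          rw [hz01, hz11, ← hbdef, ← hddef, hdetj]
          rcases he with h | h <;> rw [h] <;> norm_num
        -- move 3: `x ↔ w = y' + 2y` (determinant `1`) and `w ↔ z₂ = y' - 2y` (determinant `4`)
        by_cases hg2 : IsCoprime (d₂ + (-2) * d₁) (N : ℤ) ∧ IsCoprime (d₂ + 2 * d₁) (N : ℤ)
        · obtain ⟨γz, hz01, hz11⟩ := exists_gamma0_secondCol (N := N) _ _ (hcop_j (-2)) hg2.1
          obtain ⟨γw, hw01, hw11⟩ := exists_gamma0_secondCol (N := N) _ _ (hcop_j 2) hg2.2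
          have hχz : χ γz = 0 := ih (d₂ + (-2) * d₁).natAbs (by rw [← hn, ← hd12]; omega) γz (by rw [hz11])
          have hχw : χ γw = 0 := by
            rw [← hχz]
            refine (chi_eq_of_secondCol_of_natAbs hadd hB4 γz γw ?_).symm
            rw [hz01, hz11, hw01, hw11]
            have : (d₂ + -2 * d₁) * (b₂ + 2 * b₁) - (b₂ + -2 * b₁) * (d₂ + 2 * d₁) = 4 * e := by
              linear_combination 4 * hdet₁
            rw [this]
            rcases he with h | h <;> rw [h] <;> norm_num
          rw [← hχw]
          refine (chi_eq_of_secondCol hadd hsmall hB1 γw γ ?_).symm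
          rw [hw01, hw11, ← hbdef, ← hddef, hdetj]
          rcases he with h | h <;> rw [h] <;> norm_num
        -- otherwise: four distinct prime factors
        exfalso
        have hcop12 : IsCoprime d₁ d₂ := ⟨-(e * b₂), e * b₁, by linear_combination e * hdet₁ + he2⟩
        have h5 : ¬ IsCoprime (d₂ - 2 * d₁) (N : ℤ) ∨ ¬ IsCoprime (d₂ + 2 * d₁) (N : ℤ) := by
          by_cases h : IsCoprime (d₂ - 2 * d₁) (N : ℤ)
          · right; intro h'; exact hg2 ⟨by rw [show d₂ + -2 * d₁ = d₂ - 2 * d₁ by ring]; exact h, h'⟩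
          · left; exact h
        have h4 := four_le_card_primeFactors hN hcop12 hbad₁ hbad₂
          (by rw [show d₂ - d₁ = d₂ + -1 * d₁ by ring]; exact hg1)
          (by rw [show d₂ - 3 * d₁ = d₂ + -3 * d₁ by ring]; exact hg3) h5
        omega
      -- dispatch Case B on which parent has the smaller `d`
      rcases lt_trichotomy d' (d - d') with hlt' | heq' | hgt'
      · exact step b' d' (b - b') (d - d') (-1) (Or.inr rfl) (by ring) (by ring)
          (by linear_combination (-1 : ℤ) * hdet') hd'pos hlt' hgy hgy'
      · -- `d' = d - d'` with coprime parents forces `d' = 1`, which is prime to `N`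
        exfalso
        have hc : IsCoprime d' (d - d') := ⟨b - b', -b', by linear_combination hdet'⟩
        rw [← heq'] at hc
        have hu : IsUnit d' := isCoprime_self.mp hc
        rcases Int.isUnit_iff.mp hu with h1 | h1
        · exact hgy (by rw [h1]; exact isCoprime_one_left)
        · omega
      · exact step (b - b') (d - d') b' d' 1 (Or.inl rfl) (by ring) (by ring)
          (by linear_combination hdet') (by omega) hgt' hgy' hgy
  -- general `γ`: reduce to `d > 0` by the `−I` twist
  intro γ hn
  rcases lt_trichotomy ((γ : SL(2, ℤ)) 1 1) 0 with hneg | hzero | hpos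
  · obtain ⟨γ', -, h11, hχ⟩ := exists_neg hadd hsmall γ
    rw [← hχ]
    exact core γ' (by rw [h11]; omega) (by rw [h11, Int.natAbs_neg, hn])
  · exact chi_eq_zero_of_natAbs_d_le_one' hadd hsmall hB1 γ (by rw [hzero]; simp)
  · exact core γ hpos hn

/-! ## §4. THE NODE at every odd level with at most three distinct prime factors — UNCONDITIONALLY -/

/-- **`CuspSpanEvenAtTwo N` for every odd `N` with `ω(N) ≤ 3` — UNCONDITIONAL.** The node (G′)_N of the route (item 27436: the even
`2`-power cusp classes span the kernel of the Shimura-quotient map on `H₁(X₀(N); 𝔽₂)`) at every odd level with at most three distinct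
prime factors: all `p^a`, `p^a q^b`, `p^a q^b r^c`. Composition of rtt-p3-w4 g2's `cuspSpanEvenAtTwo_of_forall_b1_odd` (the node IS
`B₁`-generation at odd level) and free rows `|b| = 2`, `|b| = 4` (`chi_eq_zero_of_natAbs_b_eq_two_odd`,
`chi_eq_zero_of_natAbs_b_eq_four_pow_odd`) with the generation theorem `chi_eq_zero_of_rows124`. No certificate, no ERH, no Artin.
BSD is not proved by this; item 27436 stays open at `ω(N) ≥ 4`. [cite: Pollack2003, Conj. 6.3] [cite: Kulkarni1991, §2] -/
theorem cuspSpanEvenAtTwo_of_card_primeFactors_le_three [NeZero N] (hN : Odd N) (hω : N.primeFactors.card ≤ 3) :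
    CuspSpanEvenAtTwo N := by
  refine cuspSpanEvenAtTwo_of_forall_b1_odd hN fun χ' hadd hsmall hkill hb1 ↦ ?_
  exact chi_eq_zero_of_rows124 hN hω hadd hsmall (forall_b1_of_forall_b_neg_one hadd hb1)
    (fun β h ↦ chi_eq_zero_of_natAbs_b_eq_two_odd hN hadd hsmall hkill hb1 β h)
    (fun β h ↦ chi_eq_zero_of_natAbs_b_eq_four_pow_odd hN hadd hsmall hkill hb1 1 β (by rw [h]; norm_num))

/-- **`CuspSpanEvenAtTwo (p^a · q^b · r^c)`** for odd primes `p, q, r` (not necessarily distinct) and any exponents: the node at every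
odd level with at most three prime factors, in product form (covers `p²q²`, `p³q`, `pqr`, … — the levels where the `B₁`-descent fails).
[cite: Pollack2003, Conj. 6.3] -/
theorem cuspSpanEvenAtTwo_threePrimes {p q r a b c : ℕ} (hp : p.Prime) (hq : q.Prime) (hr : r.Prime) (hp2 : p ≠ 2) (hq2 : q ≠ 2)
    (hr2 : r ≠ 2) [NeZero (p ^ a * q ^ b * r ^ c)] : CuspSpanEvenAtTwo (p ^ a * q ^ b * r ^ c) := by
  have hodd : Odd (p ^ a * q ^ b * r ^ c) :=
    (((hp.odd_of_ne_two hp2).pow).mul ((hq.odd_of_ne_two hq2).pow)).mul ((hr.odd_of_ne_two hr2).pow)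
  refine cuspSpanEvenAtTwo_of_card_primeFactors_le_three hodd ?_
  have hsub : (p ^ a * q ^ b * r ^ c).primeFactors ⊆ {p, q, r} := by
    intro x hx
    obtain ⟨hx, hxd, -⟩ := Nat.mem_primeFactors.mp hx
    simp only [Finset.mem_insert, Finset.mem_singleton]
    rcases (Nat.Prime.dvd_mul hx).mp hxd with h | h
    · rcases (Nat.Prime.dvd_mul hx).mp h with h | h
      · exact Or.inl ((Nat.prime_dvd_prime_iff_eq hx hp).mp (hx.dvd_of_dvd_pow h))
      · exact Or.inr (Or.inl ((Nat.prime_dvd_prime_iff_eq hx hq).mp (hx.dvd_of_dvd_pow h)))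
    · exact Or.inr (Or.inr ((Nat.prime_dvd_prime_iff_eq hx hr).mp (hx.dvd_of_dvd_pow h)))
  exact (Finset.card_le_card hsub).trans Finset.card_le_three

/-- **FLAT at every conductor with at most three distinct prime factors.** For `W/ℚ` good supersingular at `2` with `a₂(W) = 0`, newform
`f`, and `ω(N_W) ≤ 3`: `2 ∤ L⁻` for every Pollack pair `(L⁺, L⁻)` of `f` at `2` — crux Kμ⁺'s `stub_flatMuZeroAtTwo` statement is a
THEOREM on this class of conductors (`flatAtTwo_of_cuspSpanEvenAtTwo`). BSD is not proved by this.
[cite: Pollack2003, Conj. 6.3 and Prop. 6.18] -/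
theorem flatAtTwo_of_conductor_card_primeFactors_le_three {W : WeierstrassCurve ℚ} [W.IsElliptic] [W.IsGloballyMinimal]
    [NeZero (W.conductorNorm ℤ)] {f : CuspForm (Gamma0 (W.conductorNorm ℤ)) 2} (hf : IsNewformOf W f) (hss : GoodSS W 2)
    (ha0 : W.frobeniusTrace 2 = 0) (hodd : Odd (W.conductorNorm ℤ)) (hω : (W.conductorNorm ℤ).primeFactors.card ≤ 3) :
    ∀ Lplus Lminus : IwasawaAlgebra 2, IsPollackPair f 2 Lplus Lminus → ¬ PowerSeries.C (2 : ℤ_[2]) ∣ Lminus :=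
  flatAtTwo_of_cuspSpanEvenAtTwo hf hss ha0 (cuspSpanEvenAtTwo_of_card_primeFactors_le_three hodd hω)

end Rows124

end Summit.BirchSwinnertonDyer.BirchSwinnertonDyer.Theorems.SignedMuAtTwo

end
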